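import Summits.AtomisticToContinuum.Crystallization.Theorems.SquareWellLayerCakeStackingFaultSparsityLocalFramesLimitC

/-!
# Crux `StackingFaultSparsity` (stmt-AtomisticToContinuum-14296), line `Sketch` — stub `stub_localFrameLimit`

Step S0 of the lead skeleton (pure compactness, no potential): finite configurations `y m` whose
particles within `m` of a marked particle `ik m` are each the centre of a GOOD(2, 1, 1/(m+1))
window IN THEIR OWN FRAME (lengths `a, b ∈ [19/20, 1]`, unit normal, gapped levels, labels;
flat, separated, exact `6 + 3 + 3` counts, sharp bonds) have, along a strictly increasing `φ`, a
local two-way-matching limit `X ∋ 0` of the recentred windows in which EVERY point `p` carries an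
EXACT local frame: separation `19/20`, flat levels on the open `2`-ball, the closed unit shell of
`p` is exactly a hexagon `H` at height `0` and distance `a`, an up-triple `U` at height `c 1` and
a down-triple `D` at height `c (-1)` at distance `b`, and every shell point has (in `p`'s frame)
its own `6 + 3 + 3` partners at the exact lengths with strict-radius sharpness.

Assembly of parts A–C (template: `PeriodicWindowsSketch.stub_goodLimit`):

* `lf_locframe_of_limit` — in the sequence setting of part B (normalised GOOD windows `w k`
  about `J k`, `w k (J k) → p ∈ X`, tolerances `δ k → 0`, frames
  `(a k, b k, n k, C k) → (al, bl, nl, cl)`, two-way matching with the `19/20`-separated `X`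
  near `p`), the limit set `X` carries at `p` the EXACT local frame `(al, bl, nl, cl)`:
  separation, flatness on the open `2`-ball (`lf_flat`), the shell `H ∪ U ∪ D` of `p` with its
  exactness (`lf_shell` at one late window), and at every shell point `q` the second shell
  `H'_q, U'_q, D'_q` and strict-radius sharpness — `q` is, at EVERY late window, `δ k`-close to
  a counted partner `jq` of `J k` (`lf_shell` again), whose own counted partners are matched
  into `X` (`lf_family`, `lf_matched_family`), and whose sharp bonds with the approximant of any
  `r ∈ X`, `dist q r < 1`, pass to the limit through the robust tolerance;
* `stub_localFrameLimit` — (1) the recentred windows are `19/20`-separated (separation clause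
  of the window about the first particle), so `exists_subseq_forall_eventually_ballMatch` gives
  `φ₀`, the separated limit `X` and the matching; `Filter.extraction_forall_of_eventually`
  upgrades it along `φ = φ₀ ∘ ψ` to tolerance `1/(k+1)` at radius `k` in the `k`-th window;
  `0 ∈ X` by `gl_mem_of_forall_exists_dist_le`; (2) at `p ∈ X`: approximants `J k` of `p`
  (first matching clause) are window centres (`‖·‖ ≤ ‖p‖ + 1 ≤ k ≤ φ k`), their GOOD windows
  are normalised (`lf_normalise`), the frame data `(a, b, n, C) ∈ [19/20, 1]² × 𝕊² × ∏ₜ [t-3, t+3]`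
  converge along `ψ₁` (`IsCompact.tendsto_subseq`), and `lf_locframe_of_limit` applies.
-/

noncomputable section

namespace Summit.AtomisticToContinuum.Crystallization.Theorems.SquareWellLayerCake.StackingFaultSparsity.LocalFrames.Limit

open Filter Metric Topology Literature.MathematicalPhysics.StatisticalMechanics

/-- Membership in the image finset of a family. -/
theorem lf_mem_image :
    ∀ {K : ℕ} {t : Fin K → EuclideanSpace ℝ (Fin 3)} {q : EuclideanSpace ℝ (Fin 3)}, (∃ i, t i = q) → q ∈ Finset.univ.image t := by
  intro K t q h
  obtain ⟨i, hi⟩ := h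
  exact Finset.mem_image.2 ⟨i, Finset.mem_univ _, hi⟩

/-- **The local frame of a limit point.** See the module docstring. -/
theorem lf_locframe_of_limit {X : Set (EuclideanSpace ℝ (Fin 3))} {p : EuclideanSpace ℝ (Fin 3)}
    (hXsep : ∀ q ∈ X, ∀ r ∈ X, q ≠ r → (19 : ℝ) / 20 ≤ dist q r) (hp : p ∈ X)
    {N : ℕ → ℕ} {w : (k : ℕ) → Fin (N k) → EuclideanSpace ℝ (Fin 3)} {J : (k : ℕ) → Fin (N k)}
    {a b δ : ℕ → ℝ} {n : ℕ → EuclideanSpace ℝ (Fin 3)} {C : ℕ → ℤ → ℝ}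
    {L : (k : ℕ) → Fin (N k) → ℤ}
    (hW : ∀ k, 19 / 20 ≤ a k ∧ a k ≤ 1 ∧ 19 / 20 ≤ b k ∧ b k ≤ 1 ∧ ‖n k‖ = 1 ∧ C k 0 = 0 ∧
      (∀ t : ℤ, C k t + 19 / 25 ≤ C k (t + 1)) ∧ L k (J k) = 0 ∧ 0 ≤ δ k ∧
      (∀ j : Fin (N k), dist (w k j) (w k (J k)) ≤ 2 →
        |inner ℝ (w k j - w k (J k)) (n k) - C k (L k j)| ≤ δ k) ∧
      (∀ j j' : Fin (N k), dist (w k j) (w k (J k)) ≤ 2 → dist (w k j') (w k (J k)) ≤ 2 →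
        j ≠ j' → 19 / 20 ≤ dist (w k j) (w k j')) ∧
      ∀ j : Fin (N k), dist (w k j) (w k (J k)) ≤ 1 →
        Nat.card {k' : Fin (N k) // k' ≠ j ∧ L k k' = L k j ∧ dist (w k j) (w k k') ≤ 1} = 6 ∧
        Nat.card {k' : Fin (N k) // L k k' = L k j + 1 ∧ dist (w k j) (w k k') ≤ 1} = 3 ∧
        Nat.card {k' : Fin (N k) // L k k' = L k j - 1 ∧ dist (w k j) (w k k') ≤ 1} = 3 ∧
        ∀ k' : Fin (N k), k' ≠ j → dist (w k j) (w k k') ≤ 1 →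
          (L k k' = L k j → |dist (w k j) (w k k') - a k| ≤ δ k) ∧
          (L k k' ≠ L k j → |dist (w k j) (w k k') - b k| ≤ δ k))
    (hJ : ∀ k, dist (w k (J k)) p ≤ δ k) (hδ : Tendsto δ atTop (𝓝 0))
    (hM1 : ∀ x ∈ X, ∀ᶠ k in atTop, ∃ j, dist (w k j) x ≤ δ k)
    (hM2 : ∀ R : ℝ, ∀ᶠ k in atTop, ∀ j, dist (w k j) p ≤ R → ∃ x ∈ X, dist (w k j) x ≤ δ k)
    {al bl : ℝ} {nl : EuclideanSpace ℝ (Fin 3)} {cl : ℤ → ℝ}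
    (ha : Tendsto a atTop (𝓝 al)) (hb : Tendsto b atTop (𝓝 bl)) (hn : Tendsto n atTop (𝓝 nl))
    (hC : ∀ t, Tendsto (fun k => C k t) atTop (𝓝 (cl t))) :
    19 / 20 ≤ al ∧ al ≤ 1 ∧ 19 / 20 ≤ bl ∧ bl ≤ 1 ∧ ‖nl‖ = 1 ∧ cl 0 = 0 ∧
      (∀ k : ℤ, cl k + 19 / 25 ≤ cl (k + 1)) ∧
      (∀ q ∈ X, ∀ r ∈ X, q ≠ r → 19 / 20 ≤ dist q r) ∧
      (∀ q ∈ X, dist q p < 2 → ∃ k : ℤ, inner ℝ (q - p) nl = cl k) ∧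
      (∃ H U D : Finset (EuclideanSpace ℝ (Fin 3)), H.card = 6 ∧ U.card = 3 ∧ D.card = 3 ∧
        (∀ q ∈ H, q ∈ X ∧ inner ℝ (q - p) nl = 0 ∧ dist p q = al) ∧
        (∀ q ∈ U, q ∈ X ∧ inner ℝ (q - p) nl = cl 1 ∧ dist p q = bl) ∧
        (∀ q ∈ D, q ∈ X ∧ inner ℝ (q - p) nl = cl (-1) ∧ dist p q = bl) ∧
        (∀ q ∈ X, q ≠ p → dist q p ≤ 1 → q ∈ H ∨ q ∈ U ∨ q ∈ D)) ∧
      (∀ q ∈ X, q ≠ p → dist q p ≤ 1 →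
        (∃ H' : Finset (EuclideanSpace ℝ (Fin 3)), H'.card = 6 ∧ ∀ r ∈ H', r ∈ X ∧ r ≠ q ∧
          inner ℝ (r - p) nl = inner ℝ (q - p) nl ∧ dist q r = al) ∧
        (∃ U' : Finset (EuclideanSpace ℝ (Fin 3)), U'.card = 3 ∧ ∀ r ∈ U', r ∈ X ∧
          (∃ k : ℤ, inner ℝ (q - p) nl = cl k ∧ inner ℝ (r - p) nl = cl (k + 1)) ∧
          dist q r = bl) ∧
        (∃ D' : Finset (EuclideanSpace ℝ (Fin 3)), D'.card = 3 ∧ ∀ r ∈ D', r ∈ X ∧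
          (∃ k : ℤ, inner ℝ (q - p) nl = cl k ∧ inner ℝ (r - p) nl = cl (k - 1)) ∧
          dist q r = bl) ∧
        (∀ r ∈ X, r ≠ q → dist q r < 1 →
          (inner ℝ (r - p) nl = inner ℝ (q - p) nl → dist q r = al) ∧
          (inner ℝ (r - p) nl ≠ inner ℝ (q - p) nl → dist q r = bl))) := by
  obtain ⟨hal1, hal2, hbl1, hbl2, hnl, hcl0, hclg⟩ := lf_lim_facts hW ha hb hn hC
  have hLim : 19 / 20 ≤ al ∧ al ≤ 1 ∧ 19 / 20 ≤ bl ∧ bl ≤ 1 ∧ ‖nl‖ = 1 ∧ cl 0 = 0 ∧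
      ∀ t : ℤ, cl t + 19 / 25 ≤ cl (t + 1) := ⟨hal1, hal2, hbl1, hbl2, hnl, hcl0, hclg⟩
  obtain ⟨ε, hRob⟩ := lf_robust hXsep p al bl nl cl
  have hLate := lf_late hJ hδ hM2 ha hb hn hC hRob.1
  have hflatX : ∀ x ∈ X, dist x p < 2 → ∃ t : ℤ, inner ℝ (x - p) nl = cl t :=
    fun x hx hxp => lf_flat hW hRob.2.2.2 hRob.2.1 hLate hδ hM1 hx hxp
  have hclinj : Function.Injective cl := (lf_level_strictMono hclg).injective
  -- the shell of `p`, read off ONE late window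
  obtain ⟨k₀, hk₀⟩ := hLate.exists
  obtain ⟨tH, tU, tD, hH, hU, hD, htH, htU, htD, hexact⟩ :=
    lf_shell hXsep hp hLim (hW k₀) hRob hk₀ hflatX
  -- shell points are, at EVERY late window, close to a counted partner of the centre
  have hjq : ∀ q ∈ X, q ≠ p → dist q p ≤ 1 → ∀ᶠ k in atTop,
      ∃ jq : Fin (N k), dist (w k jq) q ≤ δ k ∧ dist (w k jq) (w k (J k)) ≤ 1 := by
    intro q hq hqp hqp1
    filter_upwards [hLate] with k hk
    obtain ⟨sH, sU, sD, hsH, hsU, hsD, -, -, -, hex⟩ :=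
      lf_shell hXsep hp hLim (hW k) hRob hk hflatX
    rcases hex q hq hqp hqp1 with ⟨i, hi⟩ | ⟨i, hi⟩ | ⟨i, hi⟩
    · obtain ⟨g, hg1, hg2⟩ := (hsH i).2.2.2.2
      exact ⟨g, hi ▸ hg1, hg2⟩
    · obtain ⟨g, hg1, hg2⟩ := (hsU i).2.2.2
      exact ⟨g, hi ▸ hg1, hg2⟩
    · obtain ⟨g, hg1, hg2⟩ := (hsD i).2.2.2
      exact ⟨g, hi ▸ hg1, hg2⟩
  refine ⟨hal1, hal2, hbl1, hbl2, hnl, hcl0, hclg, hXsep, hflatX, ?_, ?_⟩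
  · refine ⟨Finset.univ.image tH, Finset.univ.image tU, Finset.univ.image tD, lf_card_image htH,
      lf_card_image htU, lf_card_image htD, ?_, ?_, ?_, fun q hq hqp hqp1 => ?_⟩
    · intro q hq
      obtain ⟨i, -, rfl⟩ := Finset.mem_image.1 hq
      exact ⟨(hH i).1, (hH i).2.2.1, (hH i).2.2.2.1⟩
    · intro q hq
      obtain ⟨i, -, rfl⟩ := Finset.mem_image.1 hq
      exact ⟨(hU i).1, (hU i).2.1, (hU i).2.2.1⟩
    · intro q hq
      obtain ⟨i, -, rfl⟩ := Finset.mem_image.1 hq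
      exact ⟨(hD i).1, (hD i).2.1, (hD i).2.2.1⟩
    · rcases hexact q hq hqp hqp1 with h | h | h
      · exact Or.inl (lf_mem_image h)
      · exact Or.inr (Or.inl (lf_mem_image h))
      · exact Or.inr (Or.inr (lf_mem_image h))
  · intro q hq hqp hqp1
    have hjq' := hjq q hq hqp hqp1
    have hqp3 : dist q p ≤ 3 := by linarith
    -- the second shell at `q`, read off one late window
    obtain ⟨k, hk, jq, hjq1, hjq2⟩ := (hLate.and hjq').exists
    have hqlab := (lf_label (hW k) hRob.2.2.2 hk.1 hRob.2.1 hk.2.1 hk.2.2.2.2.1 hk.2.2.2.2.2.1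
      hq hjq1 (hjq2.trans (by norm_num))).2.2
    obtain ⟨⟨gH, hgH, hPH⟩, ⟨gU, hgU, hPU⟩, ⟨gD, hgD, hPD⟩⟩ := lf_family (hW k) hjq2
    refine ⟨?_, ?_, ?_, fun r hr hrq hqr => ?_⟩
    · obtain ⟨t, ht, hP⟩ :=
        lf_matched_family (hW k) hRob hk hq hjq1 hjq2 hk.2.2.1 (Or.inl rfl) hgH hPH
      refine ⟨Finset.univ.image t, lf_card_image ht, fun r hr => ?_⟩
      obtain ⟨i, -, rfl⟩ := Finset.mem_image.1 hr
      exact ⟨(hP i).1, (hP i).2.1, by rw [(hP i).2.2.2.1, add_zero, hqlab], (hP i).2.2.2.2⟩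
    · obtain ⟨t, ht, hP⟩ :=
        lf_matched_family (hW k) hRob hk hq hjq1 hjq2 hk.2.2.2.1 (Or.inr rfl) hgU hPU
      refine ⟨Finset.univ.image t, lf_card_image ht, fun r hr => ?_⟩
      obtain ⟨i, -, rfl⟩ := Finset.mem_image.1 hr
      exact ⟨(hP i).1, ⟨L k jq, hqlab, (hP i).2.2.2.1⟩, (hP i).2.2.2.2⟩
    · obtain ⟨t, ht, hP⟩ :=
        lf_matched_family (hW k) hRob hk hq hjq1 hjq2 hk.2.2.2.1 (Or.inr rfl) hgD hPD
      refine ⟨Finset.univ.image t, lf_card_image ht, fun r hr => ?_⟩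
      obtain ⟨i, -, rfl⟩ := Finset.mem_image.1 hr
      exact ⟨(hP i).1, ⟨L k jq, hqlab, by rw [(hP i).2.2.2.1, sub_eq_add_neg]⟩, (hP i).2.2.2.2⟩
    · -- strict-radius sharpness at `q`, through a late window adapted to `r`
      have hqr0 : (19 : ℝ) / 20 ≤ dist q r := hXsep q hq r hr (Ne.symm hrq)
      have hpos : 0 < (1 - dist q r) / 2 := by linarith
      obtain ⟨k', ⟨⟨hk', jq', hjq1', hjq2'⟩, jr, hjr⟩, hsmall⟩ :=
        (((hLate.and hjq').and (hM1 r hr)).and (hδ.eventually (eventually_lt_nhds hpos))).exists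
      obtain ⟨hδε, hnn, haa, hbb, hCc, hJp, -⟩ := hk'
      have hWk := hW k'
      obtain ⟨-, -, -, -, -, -, -, -, hδ0, -, -, hcnt⟩ := hWk
      have hqlab' := (lf_label (hW k') hRob.2.2.2 hδε hRob.2.1 hnn hCc hJp hq hjq1'
        (hjq2'.trans (by norm_num))).2.2
      have htr := abs_le.1 (lf_dist_transfer hjq1' hjr)
      have hd1 : dist (w k' jq') (w k' jr) ≤ 1 := by linarith
      have hne : jr ≠ jq' := by
        rintro rfl
        rw [dist_self] at htr
        linarith
      have hjrJ : dist (w k' jr) (w k' (J k')) ≤ 2 :=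
        calc dist (w k' jr) (w k' (J k')) ≤ dist (w k' jq') (w k' jr) + dist (w k' jq') (w k' (J k')) :=
              dist_triangle_left _ _ _
          _ ≤ 1 + 1 := add_le_add hd1 hjq2'
          _ = 2 := by norm_num
      have hrlab := (lf_label (hW k') hRob.2.2.2 hδε hRob.2.1 hnn hCc hJp hr hjr hjrJ).2.2
      have hrp3 : dist r p ≤ 3 := by
        have := dist_triangle r q p
        rw [dist_comm r q] at this
        linarith
      obtain ⟨hs1, hs2⟩ := (hcnt jq' hjq2').2.2.2 jr hne hd1
      have haa' := abs_le.1 haa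
      have hbb' := abs_le.1 hbb
      constructor
      · intro heq
        have hL : L k' jr = L k' jq' := hclinj (by rw [← hrlab, ← hqlab', heq])
        have h1 := abs_le.1 (hs1 hL)
        refine (hRob.2.2.1 q hq r hr hqp3 hrp3).1 ?_
        rw [abs_le]
        constructor <;> linarith
      · intro hneq
        have hL : L k' jr ≠ L k' jq' := fun h => hneq (by rw [hrlab, hqlab', h])
        have h1 := abs_le.1 (hs2 hL)
        refine (hRob.2.2.1 q hq r hr hqp3 hrp3).2 ?_
        rw [abs_le]
        constructor <;> linarith

/-- STUB S0 (`stub_localFrameLimit`, pure compactness): see the module docstring. -/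
theorem stub_localFrameLimit :
    ∀ (Nk : ℕ → ℕ) (y : (m : ℕ) → Fin (Nk m) → EuclideanSpace ℝ (Fin 3)) (ik : (m : ℕ) → Fin (Nk m)), (∀ (m : ℕ) (jc : Fin (Nk m)), dist (y m jc) (y m (ik m)) ≤ (m : ℝ) → (∃ a b : ℝ, 19 / 20 ≤ a ∧ a ≤ 1 ∧ 19 / 20 ≤ b ∧ b ≤ 1 ∧ ∃ n : EuclideanSpace ℝ (Fin 3), ‖n‖ = 1 ∧ ∃ c : ℤ → ℝ, (∀ k : ℤ, c k + 19 / 25 ≤ c (k + 1)) ∧ ∃ l : Fin (Nk m) → ℤ, (∀ j : Fin (Nk m), dist (y m j) (y m jc) ≤ 2 → |inner ℝ (y m j - y m jc) n - c (l j)| ≤ 1 / ((m : ℝ) + 1)) ∧ (∀ j k : Fin (Nk m), dist (y m j) (y m jc) ≤ 2 → dist (y m k) (y m jc) ≤ 2 → j ≠ k → 19 / 20 ≤ dist (y m j) (y m k)) ∧ ∀ j : Fin (Nk m), dist (y m j) (y m jc) ≤ 1 → Nat.card {k : Fin (Nk m) // k ≠ j ∧ l k = l j ∧ dist (y m j) (y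 m k) ≤ 1} = 6 ∧ Nat.card {k : Fin (Nk m) // l k = l j + 1 ∧ dist (y m j) (y m k) ≤ 1} = 3 ∧ Nat.card {k : Fin (Nk m) // l k = l j - 1 ∧ dist (y m j) (y m k) ≤ 1} = 3 ∧ ∀ k : Fin (Nk m), k ≠ j → dist (y m j) (y m k) ≤ 1 → (l k = l j → |dist (y m j) (y m k) - a| ≤ 1 / ((m : ℝ) + 1)) ∧ (l k ≠ l j → |dist (y m j) (y m k) - b| ≤ 1 / ((m : ℝ) + 1)))) → ∃ (φ : ℕ → ℕ) (X : Set (EuclideanSpace ℝ (Fin 3))), StrictMono φ ∧ (∀ R δ : ℝ, 0 < δ → ∀ᶠ k in Filter.atTop, Literature.MathematicalPhysics.StatisticalMechanics.BallMatch δ R 0 {p | ∃ j : Fin (Nk (φ k)), dist (y (φ k) j) (y (φ k) (ik (φ k))) ≤ (φ k : ℝ) ∧ p = y (φ k) j - y (φ k) (ik (φ k))} X) ∧ (0 : EuclideanSpace ℝ (Fin 3)) ∈ X ∧ ∀ p ∈ X, ∃ (a b : ℝ) (n : EuclideanSpace ℝ (Fin 3)) (c : ℤ → ℝ), (19 / 20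 ≤ a ∧ a ≤ 1 ∧ 19 / 20 ≤ b ∧ b ≤ 1 ∧ ‖n‖ = 1 ∧ c 0 = 0 ∧ (∀ k : ℤ, c k + 19 / 25 ≤ c (k + 1)) ∧ (∀ q ∈ X, ∀ r ∈ X, q ≠ r → 19 / 20 ≤ dist q r) ∧ (∀ q ∈ X, dist q p < 2 → ∃ k : ℤ, inner ℝ (q - p) n = c k) ∧ (∃ H U D : Finset (EuclideanSpace ℝ (Fin 3)), H.card = 6 ∧ U.card = 3 ∧ D.card = 3 ∧ (∀ q ∈ H, q ∈ X ∧ inner ℝ (q - p) n = 0 ∧ dist p q = a) ∧ (∀ q ∈ U, q ∈ X ∧ inner ℝ (q - p) n = c 1 ∧ dist p q = b) ∧ (∀ q ∈ D, q ∈ X ∧ inner ℝ (q - p) n = c (-1) ∧ dist p q = b) ∧ (∀ q ∈ X, q ≠ p → dist q p ≤ 1 → q ∈ H ∨ q ∈ U ∨ q ∈ D)) ∧ (∀ q ∈ X, q ≠ p → dist q p ≤ 1 → (∃ H' : Finset (EuclideanSpace ℝ (Fin 3)), H'.card = 6 ∧ ∀ r ∈ H', r ∈ X ∧ r ≠ q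 ∧ inner ℝ (r - p) n = inner ℝ (q - p) n ∧ dist q r = a) ∧ (∃ U' : Finset (EuclideanSpace ℝ (Fin 3)), U'.card = 3 ∧ ∀ r ∈ U', r ∈ X ∧ (∃ k : ℤ, inner ℝ (q - p) n = c k ∧ inner ℝ (r - p) n = c (k + 1)) ∧ dist q r = b) ∧ (∃ D' : Finset (EuclideanSpace ℝ (Fin 3)), D'.card = 3 ∧ ∀ r ∈ D', r ∈ X ∧ (∃ k : ℤ, inner ℝ (q - p) n = c k ∧ inner ℝ (r - p) n = c (k - 1)) ∧ dist q r = b) ∧ (∀ r ∈ X, r ≠ q → dist q r < 1 → (inner ℝ (r - p) n = inner ℝ (q - p) n → dist q r = a) ∧ (inner ℝ (r - p) n ≠ inner ℝ (q - p) n → dist q r = b)))) := by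
  intro Nk y ik hloc
  -- Step 1: the recentred windows are `19/20`-separated
  have hWsep : ∀ m : ℕ, ∀ p ∈ {p : EuclideanSpace ℝ (Fin 3) | ∃ j : Fin (Nk m),
      dist (y m j) (y m (ik m)) ≤ (m : ℝ) ∧ p = y m j - y m (ik m)},
      ∀ q ∈ {p : EuclideanSpace ℝ (Fin 3) | ∃ j : Fin (Nk m),
        dist (y m j) (y m (ik m)) ≤ (m : ℝ) ∧ p = y m j - y m (ik m)},
      p ≠ q → (19 : ℝ) / 20 ≤ dist p q := by
    rintro m p ⟨j, hj, rfl⟩ q ⟨j', -, rfl⟩ hpq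
    rw [dist_sub_right]
    have hne : j ≠ j' := fun h => hpq (by rw [h])
    obtain ⟨a, b, -, -, -, -, n, -, c, -, l, -, hsep, -⟩ := hloc m j hj
    by_contra hlt
    push Not at hlt
    have := hsep j j' (by rw [dist_self]; norm_num) (by rw [dist_comm]; linarith) hne
    linarith
  obtain ⟨φ₀, X, hφ₀, hXsep, hmatch₀⟩ :=
    exists_subseq_forall_eventually_ballMatch (by norm_num : (0 : ℝ) < 19 / 20)
      (fun m => {p : EuclideanSpace ℝ (Fin 3) | ∃ j : Fin (Nk m),
        dist (y m j) (y m (ik m)) ≤ (m : ℝ) ∧ p = y m j - y m (ik m)}) hWsep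
  -- tolerance `1/(i+1)` at radius `i` in the `i`-th window, along a further subsequence `ψ`
  obtain ⟨ψ, hψ, hBM⟩ := extraction_forall_of_eventually
    (P := fun i k => BallMatch (1 / ((i : ℝ) + 1)) (i : ℝ) 0
      {p : EuclideanSpace ℝ (Fin 3) | ∃ j : Fin (Nk (φ₀ k)),
        dist (y (φ₀ k) j) (y (φ₀ k) (ik (φ₀ k))) ≤ (φ₀ k : ℝ) ∧
        p = y (φ₀ k) j - y (φ₀ k) (ik (φ₀ k))} X)
    fun i => hmatch₀ i (1 / ((i : ℝ) + 1)) (by positivity)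
  have hφ : StrictMono fun k => φ₀ (ψ k) := hφ₀.comp hψ
  have hmatch : ∀ R δ : ℝ, 0 < δ → ∀ᶠ k in Filter.atTop, BallMatch δ R 0
      {p : EuclideanSpace ℝ (Fin 3) | ∃ j : Fin (Nk (φ₀ (ψ k))),
        dist (y (φ₀ (ψ k)) j) (y (φ₀ (ψ k)) (ik (φ₀ (ψ k)))) ≤ (φ₀ (ψ k) : ℝ) ∧
        p = y (φ₀ (ψ k)) j - y (φ₀ (ψ k)) (ik (φ₀ (ψ k)))} X :=
    fun R δ hδ => hψ.tendsto_atTop.eventually (hmatch₀ R δ hδ)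
  refine ⟨fun k => φ₀ (ψ k), X, hφ, hmatch, ?_, ?_⟩
  · -- `0 ∈ X`: the origin is the image of the marked particle in every window
    refine PeriodicWindowsSketch.gl_mem_of_forall_exists_dist_le hXsep 0 fun ε hε => ?_
    obtain ⟨k, hk⟩ := exists_nat_one_div_lt hε
    have h0 : (0 : EuclideanSpace ℝ (Fin 3)) ∈
        {p : EuclideanSpace ℝ (Fin 3) | ∃ j : Fin (Nk (φ₀ (ψ k))),
          dist (y (φ₀ (ψ k)) j) (y (φ₀ (ψ k)) (ik (φ₀ (ψ k)))) ≤ (φ₀ (ψ k) : ℝ) ∧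
          p = y (φ₀ (ψ k)) j - y (φ₀ (ψ k)) (ik (φ₀ (ψ k)))} :=
      ⟨ik (φ₀ (ψ k)), by rw [dist_self]; positivity, by rw [sub_self]⟩
    obtain ⟨s, hs, hs0⟩ := (hBM k).2 0 h0 (by rw [dist_self]; positivity)
    exact ⟨s, hs, by rw [dist_comm]; exact hs0.trans hk.le⟩
  · -- the local frame at `p ∈ X`
    intro p hp
    obtain ⟨w, hw⟩ : ∃ w : (k : ℕ) → Fin (Nk (φ₀ (ψ k))) → EuclideanSpace ℝ (Fin 3),
        ∀ k j, w k j = y (φ₀ (ψ k)) j - y (φ₀ (ψ k)) (ik (φ₀ (ψ k))) := ⟨_, fun _ _ => rfl⟩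
    have hφk : ∀ k : ℕ, (k : ℝ) ≤ (φ₀ (ψ k) : ℝ) := fun k => by exact_mod_cast hφ.id_le k
    have hnorm : ∀ k j, dist (y (φ₀ (ψ k)) j) (y (φ₀ (ψ k)) (ik (φ₀ (ψ k)))) = ‖w k j‖ :=
      fun k j => by rw [hw, dist_eq_norm]
    have hδ12 : ∀ k : ℕ, 1 / ((k : ℝ) + 1) ≤ 2 / ((k : ℝ) + 1) := fun k => by
      gcongr
      norm_num
    -- first matching clause: approximants of the points of `X`
    have hM1 : ∀ x ∈ X, ∀ᶠ k in atTop, ∃ j, dist (w k j) x ≤ 2 / ((k : ℝ) + 1) := by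
      intro x hx
      filter_upwards [tendsto_natCast_atTop_atTop.eventually_ge_atTop ‖x‖] with k hk
      obtain ⟨_, ⟨j, -, rfl⟩, hj⟩ := (hBM k).1 x hx (by rwa [dist_zero_right])
      exact ⟨j, by rw [hw]; exact hj.trans (hδ12 k)⟩
    -- second matching clause: window particles near `p` are matched into `X`
    have hM2 : ∀ R : ℝ, ∀ᶠ k in atTop, ∀ j, dist (w k j) p ≤ R →
        ∃ x ∈ X, dist (w k j) x ≤ 2 / ((k : ℝ) + 1) := by
      intro R
      filter_upwards [tendsto_natCast_atTop_atTop.eventually_ge_atTop (R + ‖p‖)] with k hk j hj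
      have hjn : ‖w k j‖ ≤ k :=
        calc ‖w k j‖ = dist (w k j) 0 := (dist_zero_right _).symm
          _ ≤ dist (w k j) p + dist p 0 := dist_triangle _ _ _
          _ ≤ R + ‖p‖ := by rw [dist_zero_right]; exact add_le_add hj le_rfl
          _ ≤ k := hk
      obtain ⟨s, hs, hjs⟩ := (hBM k).2 (w k j) ⟨j, by rw [hnorm]; exact hjn.trans (hφk k), hw k j⟩
        (by rw [dist_zero_right]; exact hjn)
      exact ⟨s, hs, hjs.trans (hδ12 k)⟩
    -- normalised GOOD windows about the approximants of `p`, for late `k`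
    have hwin : ∀ᶠ k in atTop, ∃ (J : Fin (Nk (φ₀ (ψ k)))) (a b : ℝ)
        (n : EuclideanSpace ℝ (Fin 3)) (C : ℤ → ℝ) (L : Fin (Nk (φ₀ (ψ k))) → ℤ),
        dist (w k J) p ≤ 2 / ((k : ℝ) + 1) ∧
        (19 / 20 ≤ a ∧ a ≤ 1 ∧ 19 / 20 ≤ b ∧ b ≤ 1 ∧ ‖n‖ = 1 ∧ C 0 = 0 ∧
          (∀ t : ℤ, C t + 19 / 25 ≤ C (t + 1)) ∧ L J = 0 ∧ 0 ≤ 2 / ((k : ℝ) + 1) ∧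
          (∀ j : Fin (Nk (φ₀ (ψ k))), dist (w k j) (w k J) ≤ 2 →
            |inner ℝ (w k j - w k J) n - C (L j)| ≤ 2 / ((k : ℝ) + 1)) ∧
          (∀ j j' : Fin (Nk (φ₀ (ψ k))), dist (w k j) (w k J) ≤ 2 → dist (w k j') (w k J) ≤ 2 →
            j ≠ j' → 19 / 20 ≤ dist (w k j) (w k j')) ∧
          ∀ j : Fin (Nk (φ₀ (ψ k))), dist (w k j) (w k J) ≤ 1 →
            Nat.card {k' : Fin (Nk (φ₀ (ψ k))) // k' ≠ j ∧ L k' = L j ∧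
              dist (w k j) (w k k') ≤ 1} = 6 ∧
            Nat.card {k' : Fin (Nk (φ₀ (ψ k))) // L k' = L j + 1 ∧ dist (w k j) (w k k') ≤ 1} = 3 ∧
            Nat.card {k' : Fin (Nk (φ₀ (ψ k))) // L k' = L j - 1 ∧ dist (w k j) (w k k') ≤ 1} = 3 ∧
            ∀ k' : Fin (Nk (φ₀ (ψ k))), k' ≠ j → dist (w k j) (w k k') ≤ 1 →
              (L k' = L j → |dist (w k j) (w k k') - a| ≤ 2 / ((k : ℝ) + 1)) ∧
              (L k' ≠ L j → |dist (w k j) (w k k') - b| ≤ 2 / ((k : ℝ) + 1))) ∧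
        ∀ t : ℤ, (t : ℝ) - 3 ≤ C t ∧ C t ≤ (t : ℝ) + 3 := by
      filter_upwards [tendsto_natCast_atTop_atTop.eventually_ge_atTop (‖p‖ + 10)] with k hk
      obtain ⟨_, ⟨J, -, rfl⟩, hJ⟩ := (hBM k).1 p hp (by rw [dist_zero_right]; linarith)
      rw [← hw] at hJ
      have h1 : 1 / ((k : ℝ) + 1) ≤ 1 := by
        rw [div_le_one (by positivity)]
        linarith [norm_nonneg p]
      have hφk' := hφk k
      have hJc : dist (y (φ₀ (ψ k)) J) (y (φ₀ (ψ k)) (ik (φ₀ (ψ k)))) ≤ (φ₀ (ψ k) : ℝ) := by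
        rw [hnorm]
        calc ‖w k J‖ = dist (w k J) 0 := (dist_zero_right _).symm
          _ ≤ dist (w k J) p + dist p 0 := dist_triangle _ _ _
          _ ≤ 1 / ((k : ℝ) + 1) + ‖p‖ := by rw [dist_zero_right]; exact add_le_add hJ le_rfl
          _ ≤ k := by linarith
          _ ≤ φ₀ (ψ k) := hφk'
      have hη : 1 / ((φ₀ (ψ k) : ℝ) + 1) ≤ 1 / 10 :=
        one_div_le_one_div_of_le (by norm_num) (by linarith [norm_nonneg p])
      have hηδ : 2 * (1 / ((φ₀ (ψ k) : ℝ) + 1)) ≤ 2 / ((k : ℝ) + 1) := by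
        rw [mul_one_div]
        exact div_le_div_of_nonneg_left (by norm_num) (by positivity) (by linarith)
      obtain ⟨a, b, n, C, L, hWk, hCb⟩ := lf_normalise (y := w k) (jc := J) hη hηδ
        (by simpa only [hw, dist_sub_right, sub_sub_sub_cancel_right] using hloc (φ₀ (ψ k)) J hJc)
      exact ⟨J, a, b, n, C, L, hJ.trans (hδ12 k), hWk, hCb⟩
    obtain ⟨K₁, hK₁⟩ := Filter.eventually_atTop.1 hwin
    choose J a b n C L hJ hWk hCb using fun i => hK₁ (i + K₁) (Nat.le_add_left _ _)
    -- Step 3: compactness of the frame data in `[19/20, 1]² × 𝕊² × ∏ₜ [t - 3, t + 3]`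
    obtain ⟨⟨al, bl, nl, cl⟩, -, ψ₁, hψ₁, hlim⟩ :=
      (isCompact_Icc.prod (isCompact_Icc.prod
        ((isCompact_sphere (0 : EuclideanSpace ℝ (Fin 3)) 1).prod
        (isCompact_univ_pi fun t : ℤ =>
          (isCompact_Icc : IsCompact (Set.Icc ((t : ℝ) - 3) ((t : ℝ) + 3))))))).tendsto_subseq
        (x := fun i => (a i, b i, n i, C i))
        fun i => ⟨⟨(hWk i).1, (hWk i).2.1⟩, ⟨(hWk i).2.2.1, (hWk i).2.2.2.1⟩,
          mem_sphere_zero_iff_norm.2 (hWk i).2.2.2.2.1, Set.mem_univ_pi.2 fun t => hCb i t⟩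
    have hta : Tendsto (fun i => a (ψ₁ i)) atTop (𝓝 al) := hlim.fst_nhds
    have htb : Tendsto (fun i => b (ψ₁ i)) atTop (𝓝 bl) := hlim.snd_nhds.fst_nhds
    have htn : Tendsto (fun i => n (ψ₁ i)) atTop (𝓝 nl) := hlim.snd_nhds.snd_nhds.fst_nhds
    have htC : ∀ t : ℤ, Tendsto (fun i => C (ψ₁ i) t) atTop (𝓝 (cl t)) := fun t =>
      tendsto_pi_nhds.1 hlim.snd_nhds.snd_nhds.snd_nhds t
    -- Step 4: the limit data along `i ↦ ψ₁ i + K₁`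
    have hκ : Tendsto (fun i => ψ₁ i + K₁) atTop atTop :=
      (tendsto_add_atTop_nat K₁).comp hψ₁.tendsto_atTop
    have hδ' : Tendsto (fun i => 2 / (((ψ₁ i + K₁ : ℕ) : ℝ) + 1)) atTop (𝓝 0) :=
      tendsto_const_nhds.div_atTop
        (tendsto_atTop_add_const_right _ 1 (tendsto_natCast_atTop_atTop.comp hκ))
    exact ⟨al, bl, nl, cl, lf_locframe_of_limit hXsep hp (fun i => hWk (ψ₁ i)) (fun i => hJ (ψ₁ i))
      hδ' (fun x hx => hκ.eventually (hM1 x hx)) (fun R => hκ.eventually (hM2 R)) hta htb htn htC⟩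

end Summit.AtomisticToContinuum.Crystallization.Theorems.SquareWellLayerCake.StackingFaultSparsity.LocalFrames.Limit

end
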